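import Mathlib
import HarnessLib
import Summits.HubbardSuperconductivity.HubbardSuperconductivity.Theorems.KLProgrammeKLRegimeEngineV8DefsU12bG
import Summits.HubbardSuperconductivity.HubbardSuperconductivity.Theorems.KLProgrammeKLRegimeEngineV8DefsValU
import Summits.HubbardSuperconductivity.HubbardSuperconductivity.Theorems.KLProgrammeKLRegimeEngineV8PairTransferExport8
import Summits.HubbardSuperconductivity.HubbardSuperconductivity.Theorems.KLProgrammeKLRegimeEngineV8TwoLegSpaceMomentsExportZ

/-!
# K3 ENGINE package, U-level v12b AT THE G-SLOT WITH THE «A24∪A25» ENTRIES: `klEngU₀12G8 G P R cc := klEngU₀12G G P R cc ⊓ klCTu8T … ⊓ klValU P (klEngQ9c P R)`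
# — registrant text for the «A24∪A25» rev-15 motion (plan g24 (R269)(C)/(R272)(D)/(R273)(B); G := `klEngGeo14` elect; AMENDMENT 25 SHRUNK to «(X).3-KLTS-CAP» per «(A25)-FLAT-HOST-VS-CHILD1»);
# cell gate-hubbard-kl, seat gate-hubbard-kl-p1b g16 (20437 v2 registrant lineage)

WHY.  Token #14 of the «A24∪A25» image = D3G's `klEngU₀12G G P R cc` (p664965; all frozen doors + the twelve G-keyed twins) («∪Z»: + #17's Z-deferred threshold `klZspU5Z …`, …TwoLegSpaceMomentsExportZ) capped by the entries the amendment adds: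
(1) the class-#5 «KLTS-CAP» package's bundled u-slot `klCTu8T P R (klEngQ7 P R) G klEngGeoTh (klEngQ9c P R) cc = klCTu8 … ⊓ klTSCapU P` (p1 lineage's `…PairTransferExport8`: the
producer threshold of the cap′-package AND the cap's U-side booking `2²⁶·klTS·(Klam|U|) ≤ 1`); (2) the (c) value lane's `Q.CR`-keyed door `klValU P (klEngQ9c P R)` («(c)-HCU-QCR»,
…DefsValU p666690); (the frame-shift door `klShiftU <c>` of «(c)-HSHIFT-4LEG» joins when p2 names its numeral).  Rows: one `klEngU₀12G8_le_<entry>`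
per new entry (`_le_klCTu8T`, `_le_klCTu8`, `_le_klTSCapU`, `_le_klValU`), `klEngU₀12G8_le_klEngU₀12G` and through it EVERY D3G row by name (the rows §C and the
closers read: `_le_klEngU₀10`, `_le_klCUu2`, `_le_klZspU5`, `_le_klCTu7`, `_le_klIsoMomU`, `_le_klGridLitUAtG`, `_le_klTowerCoreUC9G`, the #28 literal rows, …), and
`klEngU₀12G8_pos P cc hG hP hR` (the image's witness line `klEngU₀12G8_pos P c klEngGeo14_wf hP hR`).
NOT A MOTION by itself: the image that reads these names is the pen's «A24∪A25» re-render; nothing registers here.  Definitions with bodies + order lemmas; nothing about the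
model is asserted; nothing asserts any stub of 20437, K3 or superconductivity.
-/

noncomputable section

namespace Summit.HubbardSuperconductivity.HubbardSuperconductivity.Theorems.EngineV8

set_option linter.dupNamespace false -- summit = problem name (single-conjunct summit), D-0017

open Real Finset Literature.MathematicalPhysics.QuantumLattice Literature.Probability.LatticeModels
open Summit.HubbardSuperconductivity.HubbardSuperconductivity.Theorems.KLRegimeSplit
open Summit.HubbardSuperconductivity.HubbardSuperconductivity.Theorems.KLProgrammeLegKernels
open Summit.HubbardSuperconductivity.HubbardSuperconductivity.Theorems.DispersionFlow

/-! ## §1 Token #14 of the «A24∪A25» image -/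

/-- **`klEngU₀12G8 G P R cc`** — token #14 of the «A24∪A25» image: D3G's `klEngU₀12G G P R cc` capped by the class-#5 «KLTS-CAP» bundled u-slot
`klCTu8T … (klEngQ9c P R) cc`, the (c) value lane's door `klValU P (klEngQ9c P R)` LAST. -/
def klEngU₀12G8 (G : GeoConsts) (P : SplitConsts) (R : RenConsts) (cc : ℝ) : ℝ :=
  min (klEngU₀12G G P R cc)
    (min (klCTu8T P R (klEngQ7 P R) G klEngGeoTh (klEngQ9c P R) cc)
      (min (klZspU5Z P R (klEngQ7 P R) G (klEngQ9c P R) cc)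
      (klValU P (klEngQ9c P R))))

section Projections

variable (G : GeoConsts) (P : SplitConsts) (R : RenConsts) (cc : ℝ)

/-- `klEngU₀12G8 ≤ klEngU₀12G` — every D3G door is kept. -/
theorem klEngU₀12G8_le_klEngU₀12G : klEngU₀12G8 G P R cc ≤ klEngU₀12G G P R cc := min_le_left _ _

/-- `klEngU₀12G8 ≤ klCTu8T P R (klEngQ7 P R) G klEngGeoTh (klEngQ9c P R) cc` (class #5 «KLTS-CAP» bundled u-slot; §C row for the unroll `pairTransferRelFamilyK5_klCT8_all_of_exists_T`). -/
theorem klEngU₀12G8_le_klCTu8T : klEngU₀12G8 G P R cc ≤ klCTu8T P R (klEngQ7 P R) G klEngGeoTh (klEngQ9c P R) cc := (min_le_right _ _).trans (min_le_left _ _)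

/-- `klEngU₀12G8 ≤ klCTu8 P R (klEngQ7 P R) G klEngGeoTh (klEngQ9c P R) cc` (the package's producer threshold alone; §C row for `…_all_of_exists`). -/
theorem klEngU₀12G8_le_klCTu8 : klEngU₀12G8 G P R cc ≤ klCTu8 P R (klEngQ7 P R) G klEngGeoTh (klEngQ9c P R) cc :=
  (klEngU₀12G8_le_klCTu8T G P R cc).trans (klCTu8T_le_klCTu8 P R _ _ _ _ cc)

/-- `klEngU₀12G8 ≤ klTSCapU P` (the cap's U-side booking entry). -/
theorem klEngU₀12G8_le_klTSCapU : klEngU₀12G8 G P R cc ≤ klTSCapU P := (klEngU₀12G8_le_klCTu8T G P R cc).trans (klCTu8T_le_klTSCapU P R _ _ _ _ cc)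

/-- `klEngU₀12G8 ≤ klZspU5Z P R (klEngQ7 P R) G (klEngQ9c P R) cc` («(C2)-Z-LAW» layer: #17's Z-deferred threshold; §C row for `twoLegDualSpaceMomentsUpToAt_all_of_existsZ`). -/
theorem klEngU₀12G8_le_klZspU5Z : klEngU₀12G8 G P R cc ≤ klZspU5Z P R (klEngQ7 P R) G (klEngQ9c P R) cc := (min_le_right _ _).trans ((min_le_right _ _).trans (min_le_left _ _))

/-- `klEngU₀12G8 ≤ klValU P (klEngQ9c P R)` («(c)-HCU-QCR»: k3c2-p2's `hcU'` = `hcU_of_le_klValU_wf hP (klEngQ9c_CR_nonneg P R) hU (hUle.trans (klEngU₀12G8_le_klValU …))`). -/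
theorem klEngU₀12G8_le_klValU : klEngU₀12G8 G P R cc ≤ klValU P (klEngQ9c P R) := (min_le_right _ _).trans ((min_le_right _ _).trans (min_le_right _ _))

/-! ### D3G's rows lifted through `klEngU₀12G8_le_klEngU₀12G` (names = D3G's with `12G ↦ 12G8`) -/

/-- **THE #14 LIFT LINE**: `klEngU₀12G8 ≤ klEngU₀10` (the image's `hU10`). -/
theorem klEngU₀12G8_le_klEngU₀10 : klEngU₀12G8 G P R cc ≤ klEngU₀10 P R cc := (klEngU₀12G8_le_klEngU₀12G G P R cc).trans (klEngU₀12G_le_klEngU₀10 G P R cc)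
/-- `klEngU₀12G8 ≤ klEngU₀4` (the link every (c)-closer U-door reads, e.g. p2's never-binding `hshift_door_klHshiftC_of_le_klEngU₀4`, pen (R281)(S2)). -/
theorem klEngU₀12G8_le_klEngU₀4 : klEngU₀12G8 G P R cc ≤ klEngU₀4 P R cc := (klEngU₀12G8_le_klEngU₀10 G P R cc).trans (klEngU₀10_le_klEngU₀4 P R cc)
/-- `klEngU₀12G8 ≤ klCUu2 P R (klEngQ7 P R) (klEngQ9c P R) cc` (class #1; §C row). -/
theorem klEngU₀12G8_le_klCUu2 : klEngU₀12G8 G P R cc ≤ klCUu2 P R (klEngQ7 P R) (klEngQ9c P R) cc := (klEngU₀12G8_le_klEngU₀12G G P R cc).trans (klEngU₀12G_le_klCUu2 G P R cc)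
/-- `klEngU₀12G8 ≤ klZspU5 P R (klEngQ7 P R) G (klEngQ9c P R) cc` (#17; §C row). -/
theorem klEngU₀12G8_le_klZspU5 : klEngU₀12G8 G P R cc ≤ klZspU5 P R (klEngQ7 P R) G (klEngQ9c P R) cc := (klEngU₀12G8_le_klEngU₀12G G P R cc).trans (klEngU₀12G_le_klZspU5 G P R cc)
/-- `klEngU₀12G8 ≤ klCTu7 …` (the frozen class-#5 threshold is kept). -/
theorem klEngU₀12G8_le_klCTu7 : klEngU₀12G8 G P R cc ≤ klCTu7 P R (klEngQ7 P R) G klEngGeoTh (klEngQ9c P R) cc := (klEngU₀12G8_le_klEngU₀12G G P R cc).trans (klEngU₀12G_le_klCTu7 G P R cc)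
/-- `klEngU₀12G8 ≤ klIsoMomU G P R (klEngQ9c P R) cc` (the (b) closer's row). -/
theorem klEngU₀12G8_le_klIsoMomU : klEngU₀12G8 G P R cc ≤ klIsoMomU G P R (klEngQ9c P R) cc := (klEngU₀12G8_le_klEngU₀12G G P R cc).trans (klEngU₀12G_le_klIsoMomU G P R cc)
/-- `klEngU₀12G8 ≤ klE4UF G P R (klEngQ9c P R) cc`. -/
theorem klEngU₀12G8_le_klE4UF : klEngU₀12G8 G P R cc ≤ klE4UF G P R (klEngQ9c P R) cc := (klEngU₀12G8_le_klEngU₀12G G P R cc).trans (klEngU₀12G_le_klE4UF G P R cc)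
/-- `klEngU₀12G8 ≤ klE5FrU G R`. -/
theorem klEngU₀12G8_le_klE5FrU : klEngU₀12G8 G P R cc ≤ klE5FrU G R := (klEngU₀12G8_le_klEngU₀12G G P R cc).trans (klEngU₀12G_le_klE5FrU G P R cc)
/-- `klEngU₀12G8 ≤ klE5RowsUG G P (klEngQ9c P R)`. -/
theorem klEngU₀12G8_le_klE5RowsUG : klEngU₀12G8 G P R cc ≤ klE5RowsUG G P (klEngQ9c P R) := (klEngU₀12G8_le_klEngU₀12G G P R cc).trans (klEngU₀12G_le_klE5RowsUG G P R cc)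
/-- `klEngU₀12G8 ≤ klGridLitUAtG G P R (klEngQ9c P R) cc` (the (b) closer's `hUu`). -/
theorem klEngU₀12G8_le_klGridLitUAtG : klEngU₀12G8 G P R cc ≤ klGridLitUAtG G P R (klEngQ9c P R) cc := (klEngU₀12G8_le_klEngU₀12G G P R cc).trans (klEngU₀12G_le_klGridLitUAtG G P R cc)
/-- `klEngU₀12G8 ≤ klTowerCoreUC9G G P R (klEngQ9c P R) cc` (the (b) closer's `towerCoreC9G_at_klEngQ9c` row). -/
theorem klEngU₀12G8_le_klTowerCoreUC9G : klEngU₀12G8 G P R cc ≤ klTowerCoreUC9G G P R (klEngQ9c P R) cc := (klEngU₀12G8_le_klEngU₀12G G P R cc).trans (klEngU₀12G_le_klTowerCoreUC9G G P R cc)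
/-- `klEngU₀12G8 ≤ klTwoLegMomU R (klZtG G P R) (klZs2G G P R)` (the (e) closer's `hUm`). -/
theorem klEngU₀12G8_le_klTwoLegMomU : klEngU₀12G8 G P R cc ≤ klTwoLegMomU R (klZtG G P R) (klZs2G G P R) := (klEngU₀12G8_le_klEngU₀12G G P R cc).trans (klEngU₀12G_le_klTwoLegMomU G P R cc)
/-- `klEngU₀12G8 ≤ 1/(64·(|klZs2G G P R|+1))` (the (e) closer's `hUq`). -/
theorem klEngU₀12G8_le_inv_klZs2G : klEngU₀12G8 G P R cc ≤ 1 / (64 * (|klZs2G G P R| + 1)) := (klEngU₀12G8_le_klEngU₀12G G P R cc).trans (klEngU₀12G_le_inv_klZs2G G P R cc)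
/-- `klEngU₀12G8 ≤ R.cz/(1200·(klZs1G G P R+1))` (#28 U-row). -/
theorem klEngU₀12G8_le_cz_klZs1G : klEngU₀12G8 G P R cc ≤ R.cz / (1200 * (klZs1G G P R + 1)) := (klEngU₀12G8_le_klEngU₀12G G P R cc).trans (klEngU₀12G_le_cz_klZs1G G P R cc)
/-- `klEngU₀12G8 ≤ 1/(20·(klZs1G G P R+1))` (#28 U-row). -/
theorem klEngU₀12G8_le_inv_klZs1G : klEngU₀12G8 G P R cc ≤ 1 / (20 * (klZs1G G P R + 1)) := (klEngU₀12G8_le_klEngU₀12G G P R cc).trans (klEngU₀12G_le_inv_klZs1G G P R cc)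
/-- `klEngU₀12G8 ≤ klTSU R`. -/
theorem klEngU₀12G8_le_klTSU : klEngU₀12G8 G P R cc ≤ klTSU R := (klEngU₀12G8_le_klEngU₀12G G P R cc).trans (klEngU₀12G_le_klTSU G P R cc)
/-- `klEngU₀12G8 ≤ klLastRespU P R`. -/
theorem klEngU₀12G8_le_klLastRespU : klEngU₀12G8 G P R cc ≤ klLastRespU P R := (klEngU₀12G8_le_klEngU₀12G G P R cc).trans (klEngU₀12G_le_klLastRespU G P R cc)
/-- `klEngU₀12G8 ≤ klGridU₀ R`. -/
theorem klEngU₀12G8_le_klGridU₀ : klEngU₀12G8 G P R cc ≤ klGridU₀ R := (klEngU₀12G8_le_klEngU₀12G G P R cc).trans (klEngU₀12G_le_klGridU₀ G P R cc)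
/-- `klEngU₀12G8 ≤ 1/(klReadOscC P R + 1)` (the mean-free consumers' door). -/
theorem klEngU₀12G8_le_inv_klReadOscC : klEngU₀12G8 G P R cc ≤ 1 / (klReadOscC P R + 1) := (klEngU₀12G8_le_klEngU₀12G G P R cc).trans (klEngU₀12G_le_inv_klReadOscC G P R cc)
/-- `klEngU₀12G8 ≤ klTailBookU`. -/
theorem klEngU₀12G8_le_klTailBookU : klEngU₀12G8 G P R cc ≤ klTailBookU := (klEngU₀12G8_le_klEngU₀12G G P R cc).trans (klEngU₀12G_le_klTailBookU G P R cc)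
/-- `klEngU₀12G8 ≤ klTowerUC P R (klEngQ9c P R) cc` (D1's c-slotted full tower). -/
theorem klEngU₀12G8_le_klTowerUC : klEngU₀12G8 G P R cc ≤ klTowerUC P R (klEngQ9c P R) cc := (klEngU₀12G8_le_klEngU₀12G G P R cc).trans (klEngU₀12G_le_klTowerUC G P R cc)
/-- `klEngU₀12G8 ≤ klTowerU P R (klEngQ9c P R) cc`. -/
theorem klEngU₀12G8_le_klTowerU : klEngU₀12G8 G P R cc ≤ klTowerU P R (klEngQ9c P R) cc := (klEngU₀12G8_le_klEngU₀12G G P R cc).trans (klEngU₀12G_le_klTowerU G P R cc)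
/-- `klEngU₀12G8 ≤ klE5ShareU2 P R (klEngQ9c P R) cc` (class #3). -/
theorem klEngU₀12G8_le_klE5ShareU2 : klEngU₀12G8 G P R cc ≤ klE5ShareU2 P R (klEngQ9c P R) cc := (klEngU₀12G8_le_klEngU₀12G G P R cc).trans (klEngU₀12G_le_klE5ShareU2 G P R cc)
/-- `klEngU₀12G8 ≤ klE5uM P R`. -/
theorem klEngU₀12G8_le_klE5uM : klEngU₀12G8 G P R cc ≤ klE5uM P R := (klEngU₀12G8_le_klEngU₀12G G P R cc).trans (klEngU₀12G_le_klE5uM G P R cc)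
/-- `klEngU₀12G8 ≤ klEngU₀9` (v1 door). -/
theorem klEngU₀12G8_le_klEngU₀9 : klEngU₀12G8 G P R cc ≤ klEngU₀9 P R cc := (klEngU₀12G8_le_klEngU₀12G G P R cc).trans (klEngU₀12G_le_klEngU₀9 G P R cc)
/-- `klEngU₀12G8 ≤ klEngU₀3`. -/
theorem klEngU₀12G8_le_klEngU₀3 : klEngU₀12G8 G P R cc ≤ klEngU₀3 P R cc := (klEngU₀12G8_le_klEngU₀12G G P R cc).trans (klEngU₀12G_le_klEngU₀3 G P R cc)

variable {G R}

/-- **`0 < klEngU₀12G8 G P R cc`** under `G.WF`, `P.WF`, `R.WF2` (the image's witness line `klEngU₀12G8_pos P c G_wf hP hR`; `klValU_pos` is fed `klEngQ9c_CR_nonneg`). -/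
theorem klEngU₀12G8_pos (hG : G.WF) (hP : P.WF) (hR : R.WF2) : 0 < klEngU₀12G8 G P R cc :=
  lt_min (klEngU₀12G_pos P cc hG hP hR)
    (lt_min (klCTu8T_pos P R _ _ _ _ cc) (lt_min (klZspU5Z_pos P R _ _ _ cc) (klValU_pos hP (klEngQ9c_CR_nonneg P R))))

end Projections

end Summit.HubbardSuperconductivity.HubbardSuperconductivity.Theorems.EngineV8

end
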